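import Summits.BirchSwinnertonDyer.Rank1Residual.P2.CMKolyvaginHabitatInertAtlas
import Summits.BirchSwinnertonDyer.Rank1Residual.P2.CMKolyvaginHabitatTwentySevenA4AtTwo
import HarnessLib

/-!
# Route `CMKolyvaginAtInertTwo` (leaf `WAllCornerFTwo`): the good-at-2 slice of the arithmetic
# habitat `H₂` on the CM-inert-at-2 atlas, in closed form (where Abbes–Ullmo gives the Manin binder)

Cell `bsd-print-cf2`, seat ty2 (discharge interface), line `route-BirchSwinnertonDyer-CMKolyvaginAtInertTwo`
(items stmt-BirchSwinnertonDyer-24276/24277, residual 22838). HONEST FRAMING: THEOREMS ONLY — no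
definition, no named fact, no route file imported, nothing about BSD asserted or booked; the leaf is OPEN.

`CMKolyvaginHabitatInertAtlas.surjective_and_odd_tamagawaProduct_iff_of_cmInert_two` says that a CM
curve with `2` inert satisfies the image and Tamagawa binders of `H₂` iff it is a Mordell curve
`y² = x³ + k` with the `k`-criterion or a silent twist `27a4^{(d)}`. Here the prime `2` is added:

* `hasGoodReductionAtPrime_two_iff_of_cmInert_two` — on that locus, **`E` is good at `2 ⟺`
  (row (a)) `v₂(k) ≡ 4 (mod 6)` and `k/2^{v₂(k)} ≡ 1 (mod 4)`, or (row (c)) `d ≡ 1 (mod 4)`**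
  (`Mordell.hasGoodReductionAtPrime_two_of_model_iff`, `TwentySevenA4.hasGoodReductionAtPrime_two_twist_iff`);
* `maninBinder_iff_isOptimal_of_cmInert_two_of_hasGoodReductionAtPrime_two` — there the habitat's
  Manin binder `∃ Dt, Λ_E ⊆ c·Λ_f ∧ Odd c` is EXACTLY "`E` is optimal", modulo Abbes–Ullmo (`hAU`);
  off it `4 ∣ N` and the binder stays a hypothesis (`two_dvd_conductorNorm_of_not_goodSlice`).

References: Abbes–Ullmo 1996 Thm. A [AbbesUllmo1996]; Silverman *ATAEC* IV.9.4 Table 4.1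
[SilvermanATAEC1994]; Barrios et al. 2025 Thm. 5.1 [BarriosEtAl2025]; Silverman *AEC* VII.5.1(a) [SilvermanAEC2009].
-/

set_option autoImplicit false

noncomputable section

open scoped Classical NumberField

open WeierstrassCurve NumberField Literature.NumberTheory.EllipticCurves
  Literature.NumberTheory.EllipticCurves.ModularForms Literature.NumberTheory.EllipticCurves.Rank1Residual
  Summit.BirchSwinnertonDyer.Rank1Residual.P2

namespace Summit.BirchSwinnertonDyer.Rank1Residual.P2.InertAtlas

variable (W : WeierstrassCurve ℚ) [W.IsElliptic]

/-- **GOOD REDUCTION AT `2` ON THE ARITHMETIC HABITAT, DECIDED.** For a globally minimal CM curve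
`E/ℚ` with `2` inert, `ρ̄_{E,2}` onto and `Odd ∏ c_ℓ`: `E` is good at `2` iff EITHER
`E ≅ (y² = x³ + k)` with `k ≠ 0`, `v₂(k) ≡ 4 (mod 6)`, `k/2^{v₂(k)} ≡ 1 (mod 4)`, OR `E ≅ 27a4^{(d)}` with
`d` square-free, `d ≡ 1 (mod 4)`. [cite: SilvermanATAEC1994, IV.9.4 and Table 4.1]
[cite: BarriosEtAl2025, Thm. 5.1 (rows R = I₀)] [cite: SilvermanAEC2009, VII.5 Prop. 5.1(a) and X.5 Prop. 5.4] -/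
theorem hasGoodReductionAtPrime_two_iff_of_cmInert_two [W.IsGloballyMinimal] (hCM : W.HasCM)
    (hin : CMInert W 2) (hH : W.HasSurjectiveModNGaloisRep 2 ∧ Odd W.tamagawaProduct) :
    W.HasGoodReductionAtPrime 2 ↔
      ((∃ k : ℤ, k ≠ 0 ∧ (∃ C : VariableChange ℚ, C • (⟨0, 0, 0, 0, (k : ℚ)⟩ : WeierstrassCurve ℚ) = W) ∧
          k.natAbs.factorization 2 % 6 = 4 ∧ k / (2 : ℤ) ^ k.natAbs.factorization 2 % 4 = 1) ∨
        ∃ d : ℤ, d ≠ 0 ∧ Squarefree d ∧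
          (∃ C : VariableChange ℚ,
            C • (⟨0, 0, 1, -30, 63⟩ : WeierstrassCurve ℚ).quadraticTwist (d : ℚ) = W) ∧ d % 4 = 1) := by
  constructor
  · intro hgood
    rcases (surjective_and_odd_tamagawaProduct_iff_of_cmInert_two W hCM hin).mp hH with
      ⟨k, hk, ⟨C, hC⟩, -⟩ | ⟨d, hd, hsq, ⟨C, hC⟩, -⟩
    · exact Or.inl ⟨k, hk, ⟨C, hC⟩, (Mordell.hasGoodReductionAtPrime_two_of_model_iff W hk hC).mp hgood⟩
    · have hC' : C⁻¹ • W = (⟨0, 0, 1, -30, 63⟩ : WeierstrassCurve ℚ).quadraticTwist (d : ℚ) := by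
        rw [← hC, inv_smul_smul]
      exact Or.inr ⟨d, hd, hsq, ⟨C, hC⟩,
        (TwentySevenA4.hasGoodReductionAtPrime_two_twist_iff W hsq hC').mp hgood⟩
  · rintro (⟨k, hk, ⟨C, hC⟩, h2⟩ | ⟨d, hd, hsq, ⟨C, hC⟩, hd4⟩)
    · exact (Mordell.hasGoodReductionAtPrime_two_of_model_iff W hk hC).mpr h2
    · have hC' : C⁻¹ • W = (⟨0, 0, 1, -30, 63⟩ : WeierstrassCurve ℚ).quadraticTwist (d : ℚ) := by
        rw [← hC, inv_smul_smul]
      exact TwentySevenA4.hasGoodReductionAtPrime_two_twist_of_emod_four_eq_one W hd4 hC'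

/-- **On the good-at-2 slice the Manin binder is exactly optimality** (Abbes–Ullmo at `p = 2`, `2 ∤ N`;
g7's `maninBinder_iff_exists_isOptimalDatum_of_not_two_dvd_conductorNorm`). [cite: AbbesUllmo1996, Thm. A] -/
theorem maninBinder_iff_isOptimal_of_hasGoodReductionAtPrime_two [W.IsGloballyMinimal]
    [NeZero (W.conductorNorm ℤ)] (hAU : abbesUllmo_not_dvd_maninConstant_of_not_dvd_level)
    (hgood : W.HasGoodReductionAtPrime 2) :
    (∃ Dt : ModularParametrizationData W (W.conductorNorm ℤ),
      (∀ z ∈ Dt.L.lattice, ∃ w ∈ periodLattice Dt.f, z = (Dt.c : ℂ) * w) ∧ Odd Dt.c) ↔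
    ∃ Dt : ModularParametrizationData W (W.conductorNorm ℤ), ShuZhai2021.IsOptimalDatum W Dt :=
  haveI : Fact (Nat.Prime 2) := ⟨Nat.prime_two⟩
  maninBinder_iff_exists_isOptimalDatum_of_not_two_dvd_conductorNorm W hAU
    fun h => (W.dvd_conductorNorm_iff_not_hasGoodReductionAtPrime 2).mp h hgood

/-- **Off the good-at-2 slice, `2 ∣ N`** (so the Manin binder is a genuine hypothesis there: no printed
theorem controls `ord₂` of the Manin constant when `4 ∣ N`). On the arithmetic habitat this is: row (a)
without (`v₂(k) ≡ 4 (6)` and `u₂ ≡ 1 (4)`), or row (c) with `d ≢ 1 (mod 4)`.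
[cite: SilvermanATAEC1994, IV.9.4 and Table 4.1] [cite: BarriosEtAl2025, Thm. 5.1 (rows R = I₀)] -/
theorem two_dvd_conductorNorm_of_not_goodSlice [W.IsGloballyMinimal] (hCM : W.HasCM) (hin : CMInert W 2)
    (hH : W.HasSurjectiveModNGaloisRep 2 ∧ Odd W.tamagawaProduct)
    (ha : ∀ k : ℤ, k ≠ 0 → (∃ C : VariableChange ℚ, C • (⟨0, 0, 0, 0, (k : ℚ)⟩ : WeierstrassCurve ℚ) = W) →
      ¬ (k.natAbs.factorization 2 % 6 = 4 ∧ k / (2 : ℤ) ^ k.natAbs.factorization 2 % 4 = 1))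
    (hc : ∀ d : ℤ, d ≠ 0 → Squarefree d →
      (∃ C : VariableChange ℚ, C • (⟨0, 0, 1, -30, 63⟩ : WeierstrassCurve ℚ).quadraticTwist (d : ℚ) = W) →
      d % 4 ≠ 1) :
    2 ∣ W.conductorNorm ℤ := by
  haveI : Fact (Nat.Prime 2) := ⟨Nat.prime_two⟩
  rw [W.dvd_conductorNorm_iff_not_hasGoodReductionAtPrime 2,
    hasGoodReductionAtPrime_two_iff_of_cmInert_two W hCM hin hH]
  rintro (⟨k, hk, hC, h2⟩ | ⟨d, hd, hsq, hC, hd4⟩)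
  · exact ha k hk hC h2
  · exact hc d hd hsq hC hd4

end Summit.BirchSwinnertonDyer.Rank1Residual.P2.InertAtlas

end
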